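import Literature.MathematicalPhysics.QuantumFieldTheory.Balaban1983to89.B5Local114GLatticeSecond
import Literature.MathematicalPhysics.QuantumFieldTheory.Balaban1983to89.B5SettingP12Real
import Literature.MathematicalPhysics.QuantumFieldTheory.Balaban1983to89.B5PBridgeKernel126

/-!
# `Balaban1983to89.B5Local114GLattice` — Bałaban CMP 95 (1984), Proposition 1.2, **(1.114) FOR `G = Δ_a⁻¹` ON THE LATTICE
# TORI OF RECORD**, as the family statement `B5.Local114Fam`: for every family of tori `T_η`, `η = 1/n_i`, periods `M_i`,
# UNDER the printed kernel bound (1.126) on `∂P∂*` with uniform constants, the six localised `L²` bounds hold with ONE `δ₀`, ONE `O(1)`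

statement-level skeleton of published theorems with citation tags; proofs where landed; nothing here is a claim
about the Yang–Mills mass gap

Source (lit-balaban cell, Phase-2 proof seat p37 gen 7): T. Bałaban, *Propagators and renormalization transformations
for lattice gauge theories. I*, Commun. Math. Phys. **95** (1984) 17–40 [`Balaban1984PropagatorsI`, "B5"], Prop. 1.2
(1.114) p. 36 [PDF 20], (1.126) p. 38 [PDF 22], p. 39 [PDF 23]; held as `paper:balaban1984-cmp95-propagators-rt-i`.
Unit `lit-balaban-p37`, HOME `run/shared/lean/pub/lit-balaban/` (SKELETON row B5.Prop1.2, owner's census item (vi)-G).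

## WHAT IS PRINTED (verbatim)

p. 36 [PDF 20], (1.114): «Finally there exists a constant O(1) such that
  ‖ζGJ‖, ‖ζ∇GJ‖, ‖ζG∇*J‖, ‖ζ∇G∇*J‖, ‖ζ∇∇GJ‖, ‖ζG∇*∇*J‖ ≤ O(1)e^{−δ₀|y−y′|}|ζ| ‖J‖   (1.114)
for supp ζ ⊂ Δ̃(y), supp J ⊂ Δ̃(y′).»  p. 35 [PDF 19] ll. 32–35, the head of the proposition: «Proposition 1.2. There
exists a positive constant δ₀ depending on d only, such that |(GJ)(x)|, |(∇GJ)(x)|, |(G∇*J)(x)|, |(ΔGJ)(x)| ≤ O(1)e^{−δ₀|y−y′|}|J|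
(1.110) for x ∈ Δ̃(y), supp J ⊂ Δ̃(y′), with the constant O(1) depending on d only, …» (the cubes, same page: «Cubes Δ̃(y) are
sums of 2ᵈ unit cubes having the point y as a corner, thus they are cubes of size 2 and with a center at y»; uniformity in the
torus is printed on p. 33 l. 7 for γ₀: «independent of k, T_η, and depending on d only»).  p. 38 [PDF 22], (1.126):
«|(∂P∂*)_{μ,ν}(x, x′)| ≤ O(1)e^{−δ′₀|x−x′|} … The constant O(1) in (1.126) depends on d only».  p. 39 [PDF 23]: «the proof of
inequalities (1.114) … is completed because we have proved inequalities (1.89).»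
(v1.1 docstring note, ref-1 g38/g39 + r05 pass 15-(a): the v1.0 header put a paraphrase «There exist constants δ₀ > 0 and O(1)
depending on d only and such that for arbitrary T_η, …» in guillemets — that is the shape of the tree's typed predicate
`B5.Local114Fam`, NOT print; «for arbitrary T_η» is not printed on pp. 35–36.  No declaration changed.)

## WHAT THIS MODULE PROVES (kernel-checked, zero sorry)

* `l2locL_le` — all six entries at once on one torus: `l2locL n M a m J ζ ≤ C₁₁₄·e^{−δ₁|y−y′|}·|ζ|·‖J‖` for `supp ζ ⊂ Δ̃(y)`,
  `supp J ⊂ Δ̃(y′)`, with `δ₁ = delta1 d a δ′ C`, `C₁₁₄ = C114 d a δ′ C` depending on `d, a` and the constants `δ′, C` of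
  (1.126) ONLY (not on `η`, the torus, `y, y′`);
* `local114Fam_latticeSettingP12`, `local114Fam_latticeSettingP12W`, `local114Fam_latticeSettingP12R` — **`B5.Local114Fam`
  for the three torus families of record** (`B5Prop12FieldsLattice.latticeSettingP12`, the `η^{d/2}`-weighted
  `B5SettingP12Weighted.latticeSettingP12W`, and the REAL-field setting `B5SettingP12Real.latticeSettingP12R` that carries the
  G-route), for arbitrary index sets `I ∋ i ↦ (n_i, M_i, k_i)`, UNDER the uniform printed bound (1.126) `h126` on
  `dPd (n i) (M i) = GradOp·PcT·GradOpᴴ`;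
* §4 **THE HYPOTHESIS-FREE FORMS**: (1.126) for `∂·PcT·∂ᴴ` is PROVED in the tree (p16's P-bridge
  `B5PBridgeKernel126.norm_GradOp_PcT_GradOp_adjoint_le_of_pos`, every `d ≥ 1`; `d = 0` is vacuous), whence the constants of
  record `deltaP d`, `constP d`, `delta114 d a`, `const114 d a` (depending on `d, a` ONLY) and
  `l2locL_le_printed` (all six entries on every torus, no hypothesis besides `1 ≤ n`, `0 < a`),
  `local114Fam_latticeSettingP12R_printed` / `…P12W_printed` / `…P12_printed` — **`B5.Local114Fam` for Bałaban's G on the torus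
  families of record, sorry-free and hypothesis-free**.

## HONEST SCOPE / DIVERGENCE

(1) The hypothesis `h126` of §2–§3 is (1.126) read on r02's matrix of record with the (1.120) kernel convention
`η^d(∂P∂*)(x,x′)`; §4 discharges it by the tree's P-bridge (`B5PBridgeKernel126`, p16 — the identification of `PcT` with the
multiplier presentation and `B5DPD126Uniform`), so the `_printed` forms carry no hypothesis.  (2) Method = the p. 36 alternative (Combes–Thomas on the
torus + interior H² localisation), a disclosed divergence from the printed random walk; the STATEMENT is the tree's typed
(1.114) verbatim.  (3) `a > 0` is one fixed parameter of the family, as in the paper; `δ₁`, `C₁₁₄` ours and explicit.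
CELL BOOK-KEEPING (lit-balaban): row B5.Prop1.2, census item (vi)-G (owner r02, referee ref-4); VALUE = (1.114) for
Bałaban's G on the torus family, kernel-checked (the leaf (1.126) being the tree's proved P-bridge) — NOT summit progress.
-/

namespace Literature.MathematicalPhysics.QuantumFieldTheory.Balaban1983to89.B5Local114GLattice

open scoped BigOperators Matrix ComplexConjugate ComplexOrder Matrix.Norms.L2Operator
open Finset Complex Matrix
open Literature.MathematicalPhysics.QuantumFieldTheory.Balaban1983to89.B5Prop11Plancherel (Tor fine fdiff unitVec)
open Literature.MathematicalPhysics.QuantumFieldTheory.Balaban1983to89.B5Prop11Lower (Lap nsq nsq_nonneg)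
open Literature.MathematicalPhysics.QuantumFieldTheory.Balaban1983to89.B5Prop11Lattice (gammaZero gammaZero_pos l2 l2T
  l2_nonneg l2T_nonneg grad grad2 divT divT2)
open Literature.MathematicalPhysics.QuantumFieldTheory.Balaban1983to89.B5Prop11SettingModel (Loc189 locNorm locNorm_nonneg)
open Literature.MathematicalPhysics.QuantumFieldTheory.Balaban1983to89.B5Prop12FieldsLattice (cdistF distU distSite
  toFine cubeT distU_nonneg distSite_nonneg smulV smulT cutInL cutSupL cutSupL_nonneg suppInL l2locL latticeSettingP12)
open Literature.MathematicalPhysics.QuantumFieldTheory.Balaban1983to89.B5SettingP12Weighted (latticeSettingP12W sqEta sqEta_nonneg)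
open Literature.MathematicalPhysics.QuantumFieldTheory.Balaban1983to89.B5SettingP12Real (latticeSettingP12R LocR)
open Literature.MathematicalPhysics.QuantumFieldTheory.Balaban1983to89.B5DeltaA169 (DeltaA)
open Literature.MathematicalPhysics.QuantumFieldTheory.Balaban1983to89.B5CombesThomasLattice
open Literature.MathematicalPhysics.QuantumFieldTheory.Balaban1983to89.B5CombesThomasLatticeSolve
open Literature.MathematicalPhysics.QuantumFieldTheory.Balaban1983to89.B5Local114GLatticeFirst
open Literature.MathematicalPhysics.QuantumFieldTheory.Balaban1983to89.B5Local114GLatticeSecond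

noncomputable section

variable {d : ℕ}

/-! ## §1 The constants -/

/-- the constant of the m = 0 entry at exponent `δ`. [cite: Balaban1984PropagatorsI, Prop. 1.2 (1.114) p.36 (O(1)); value ours] -/
def c0 (d : ℕ) (a δ : ℝ) : ℝ := Real.exp (2 * δ) * (2 * Real.exp δ / gammaZero d a)

/-- the constant of the m = 1 entry. [cite: Balaban1984PropagatorsI, Prop. 1.2 (1.114) p.36 (O(1)); value ours] -/
def c1 (d : ℕ) (a δ : ℝ) : ℝ := Real.sqrt (18 * (d + 1)) * Real.exp (2 * δ) * (2 * Real.exp δ / gammaZero d a)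

/-- the constant of the m = 2 entry. [cite: Balaban1984PropagatorsI, Prop. 1.2 (1.114) p.36 (O(1)); value ours] -/
def c2 (d : ℕ) (a δ : ℝ) : ℝ := Real.exp (2 * δ) * Real.sqrt (72 * (d + 1) * Real.exp (2 * δ) / gammaZero d a ^ 2)

/-- the constant of the m = 3 entry. [cite: Balaban1984PropagatorsI, Prop. 1.2 (1.114) p.36 (O(1)); value ours] -/
def c3 (d : ℕ) (a δ : ℝ) : ℝ :=
  Real.sqrt (18 * (d + 1)) * Real.exp (2 * δ) * Real.sqrt (72 * (d + 1) * Real.exp (2 * δ) / gammaZero d a ^ 2)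

/-- the constant of the m = 4, 5 entries. [cite: Balaban1984PropagatorsI, Prop. 1.2 (1.114) p.36 (O(1)); value ours] -/
def c4 (d : ℕ) (a δ' C δ : ℝ) : ℝ := Real.sqrt (C4sq d a δ' C δ)

/-- **the (1.114) constant `O(1)` for G on the torus family** (ours): the max of the six entry constants at `δ = δ₁`.
[cite: Balaban1984PropagatorsI, Prop. 1.2 (1.114) p.36 (O(1)); value ours] -/
def C114 (d : ℕ) (a δ' C : ℝ) : ℝ :=
  max (c0 d a (delta1 d a δ' C)) (max (c1 d a (delta1 d a δ' C)) (max (c2 d a (delta1 d a δ' C))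
    (max (c3 d a (delta1 d a δ' C)) (c4 d a δ' C (delta1 d a δ' C)))))

/-- `0 < c0`. [cite: Balaban1984PropagatorsI, Prop. 1.2 (1.114) p.36; value ours] -/
theorem c0_pos (d : ℕ) (a δ : ℝ) : 0 < c0 d a δ := by
  unfold c0; have := gammaZero_pos d a; positivity

/-- `0 < C₁₁₄`. [cite: Balaban1984PropagatorsI, Prop. 1.2 (1.114) p.36; value ours] -/
theorem C114_pos (d : ℕ) (a δ' C : ℝ) : 0 < C114 d a δ' C :=
  lt_max_of_lt_left (c0_pos d a _)

/-! ## §2 All six entries on one torus -/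

section OneTorus

variable (n : ℕ) [NeZero n] (M : Fin d → ℕ) [hM : ∀ μ, NeZero (M μ)]

/-- monotonicity in the constant. [cite: Balaban1984PropagatorsI, Prop. 1.2 (1.114) p.36 (O(1))] -/
private theorem lift_const {x c C E Z N : ℝ} (hE : 0 ≤ E) (hZ : 0 ≤ Z) (hN : 0 ≤ N) (hc : c ≤ C)
    (h : x ≤ c * E * Z * N) : x ≤ C * E * Z * N := by
  have : c * E * Z * N ≤ C * E * Z * N := by
    have h0 : 0 ≤ E * Z * N := by positivity
    nlinarith
  exact h.trans this

/-- **(1.114) FOR `G = Δ_a⁻¹` ON ONE TORUS, ALL SIX ENTRIES** (r02's `l2locL`, m = 0…5, vector / tensor / 2-tensor sources),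
UNDER (1.126): `l2locL m J ζ ≤ C₁₁₄·e^{−δ₁|y−y′|}·|ζ|·‖J‖` for `supp ζ ⊂ Δ̃(y)`, `supp J ⊂ Δ̃(y′)` — constants independent of
`η = 1/n`, the torus and `y, y′`. [cite: Balaban1984PropagatorsI, Prop. 1.2 (1.114) p.36, p.39; proof ours by the p.36 route] -/
theorem l2locL_le (hn : 1 ≤ n) {a : ℝ} (ha : 0 < a) {δ' C : ℝ} (hδ' : 0 < δ') (hC : 0 ≤ C)
    (h126 : ∀ i j, ‖dPd n M i j‖ ≤ C * ((n : ℝ) ^ d)⁻¹ * Real.exp (-(δ' * distU n M i.1 j.1)))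
    (m : Fin 6) (J : Loc189 n M) (ζ : Tor (fine n M) → ℝ) {y y' : Tor M} (hζ : cutInL n M ζ y) (hJ : suppInL n M J y') :
    l2locL n M a m J ζ
      ≤ C114 d a δ' C * Real.exp (-(delta1 d a δ' C * distSite M y y')) * cutSupL n M ζ * locNorm J := by
  have hδ0 : 0 ≤ delta1 d a δ' C := (delta1_pos (d := d) ha hδ' hC).le
  have hE : 0 ≤ Real.exp (-(delta1 d a δ' C * distSite M y y')) := (Real.exp_pos _).le
  have hZ : 0 ≤ cutSupL n M ζ := cutSupL_nonneg ζ
  have hN : 0 ≤ locNorm J := locNorm_nonneg J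
  have hRHS : 0 ≤ C114 d a δ' C * Real.exp (-(delta1 d a δ' C * distSite M y y')) * cutSupL n M ζ * locNorm J :=
    mul_nonneg (mul_nonneg (mul_nonneg (C114_pos d a δ' C).le hE) hZ) hN
  -- the five constant comparisons
  have k0 : c0 d a (delta1 d a δ' C) ≤ C114 d a δ' C := le_max_left _ _
  have k1 : c1 d a (delta1 d a δ' C) ≤ C114 d a δ' C := le_max_of_le_right (le_max_left _ _)
  have k2 : c2 d a (delta1 d a δ' C) ≤ C114 d a δ' C := le_max_of_le_right (le_max_of_le_right (le_max_left _ _))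
  have k3 : c3 d a (delta1 d a δ' C) ≤ C114 d a δ' C :=
    le_max_of_le_right (le_max_of_le_right (le_max_of_le_right (le_max_left _ _)))
  have k4 : c4 d a δ' C (delta1 d a δ' C) ≤ C114 d a δ' C :=
    le_max_of_le_right (le_max_of_le_right (le_max_of_le_right (le_max_right _ _)))
  cases J with
  | vec J =>
      have hJ' : ∀ i, J i ≠ 0 → i.1 ∈ cubeT n M y' := hJ
      have hN' : 0 ≤ l2 J := l2_nonneg J
      fin_cases m
      · exact lift_const hE hZ hN' k0 (l2_smulV_G_le n M hn ha hδ' hC h126 hδ0 le_rfl hζ hJ')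
      · exact lift_const hE hZ hN' k1 (l2T_smulT_gradG_le n M hn ha hδ' hC h126 hδ0 le_rfl hζ hJ')
      · exact hRHS
      · exact hRHS
      · exact lift_const hE hZ hN' k4 (l2T_smulT_grad2G_le n M hn ha hδ' hC h126 hδ0 le_rfl hζ hJ')
      · exact hRHS
  | ten J =>
      have hJ' : ∀ ν i, J ν i ≠ 0 → i.1 ∈ cubeT n M y' := hJ
      have hN' : 0 ≤ l2T J := l2T_nonneg J
      fin_cases m
      · exact hRHS
      · exact hRHS
      · exact lift_const hE hZ hN' k2 (l2_smulV_GdivT_le n M hn ha hδ' hC h126 hδ0 le_rfl hζ hJ')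
      · exact lift_const hE hZ hN' k3 (l2T_smulT_gradGdivT_le n M hn ha hδ' hC h126 hδ0 le_rfl hζ hJ')
      · exact hRHS
      · exact hRHS
  | ten2 J =>
      have hJ' : ∀ p i, J p i ≠ 0 → i.1 ∈ cubeT n M y' := hJ
      have hN' : 0 ≤ l2T J := l2T_nonneg J
      fin_cases m
      · exact hRHS
      · exact hRHS
      · exact hRHS
      · exact hRHS
      · exact hRHS
      · exact lift_const hE hZ hN' k4 (l2_smulV_GdivT2_le n M hn ha hδ' hC h126 hδ0 le_rfl hζ hJ')

end OneTorus

/-! ## §3 `B5.Local114Fam` for the torus families of record, under the uniform printed bound (1.126) -/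

/-- **(1.114) FOR G, THE FAMILY STATEMENT — `latticeSettingP12`**: for any family of tori `(n_i, M_i)` and labels `k_i`, UNDER
the uniform bound (1.126) on `∂P∂*`, `B5.Local114Fam` holds with `δ₀ = δ₁(d, a, δ′, C)`, `O(1) = C₁₁₄(d, a, δ′, C)`.
[cite: Balaban1984PropagatorsI, Prop. 1.2 (1.114) p.36, (1.126) p.38, p.39; proof ours by the p.36 route] -/
theorem local114Fam_latticeSettingP12 {I : Type} (n : I → ℕ) [∀ i, NeZero (n i)] (M : I → Fin d → ℕ)
    [∀ i μ, NeZero (M i μ)] (k : I → ℕ) (hn : ∀ i, 1 ≤ n i) {a : ℝ} (ha : 0 < a) {δ' C : ℝ} (hδ' : 0 < δ') (hC : 0 ≤ C)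
    (h126 : ∀ i, ∀ p q, ‖dPd (n i) (M i) p q‖ ≤ C * (((n i : ℕ) : ℝ) ^ d)⁻¹ * Real.exp (-(δ' * distU (n i) (M i) p.1 q.1))) :
    B5.Local114Fam (fun i => latticeSettingP12 (n i) (M i) a (k i)) := by
  refine ⟨delta1 d a δ' C, C114 d a δ' C, delta1_pos (d := d) ha hδ' hC, C114_pos d a δ' C, ?_⟩
  intro i m J ζ y y' hζ hJ
  exact l2locL_le (n i) (M i) (hn i) ha hδ' hC (h126 i) m J ζ hζ hJ

/-- **(1.114) FOR G, THE FAMILY STATEMENT — the `η^{d/2}`-weighted setting `latticeSettingP12W`** (both sides of (1.114) carry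
the same factor `η^{d/2}`). [cite: Balaban1984PropagatorsI, Prop. 1.2 (1.114) p.36, (1.21) p.21 (η^d in the norms), (1.126) p.38; proof ours] -/
theorem local114Fam_latticeSettingP12W {I : Type} (n : I → ℕ) [∀ i, NeZero (n i)] (M : I → Fin d → ℕ)
    [∀ i μ, NeZero (M i μ)] (k : I → ℕ) (hn : ∀ i, 1 ≤ n i) {a : ℝ} (ha : 0 < a) {δ' C : ℝ} (hδ' : 0 < δ') (hC : 0 ≤ C)
    (h126 : ∀ i, ∀ p q, ‖dPd (n i) (M i) p q‖ ≤ C * (((n i : ℕ) : ℝ) ^ d)⁻¹ * Real.exp (-(δ' * distU (n i) (M i) p.1 q.1))) :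
    B5.Local114Fam (fun i => latticeSettingP12W (n i) (M i) a (k i)) := by
  refine ⟨delta1 d a δ' C, C114 d a δ' C, delta1_pos (d := d) ha hδ' hC, C114_pos d a δ' C, ?_⟩
  intro i m J ζ y y' hζ hJ
  have h := l2locL_le (n i) (M i) (hn i) ha hδ' hC (h126 i) m J ζ hζ hJ
  have hs := sqEta_nonneg (n i) d
  show sqEta (n i) d * l2locL (n i) (M i) a m J ζ
    ≤ C114 d a δ' C * Real.exp (-(delta1 d a δ' C * distSite (M i) y y')) * cutSupL (n i) (M i) ζ * (sqEta (n i) d * locNorm J)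
  calc sqEta (n i) d * l2locL (n i) (M i) a m J ζ
      ≤ sqEta (n i) d * (C114 d a δ' C * Real.exp (-(delta1 d a δ' C * distSite (M i) y y')) * cutSupL (n i) (M i) ζ * locNorm J) :=
        mul_le_mul_of_nonneg_left h hs
    _ = _ := by ring

/-- **(1.114) FOR G, THE FAMILY STATEMENT — the REAL-field setting of record `latticeSettingP12R`** (the carrier of the G-route,
r02's census item (vi)-G), UNDER the uniform printed bound (1.126) on `∂P∂*`.
[cite: Balaban1984PropagatorsI, Prop. 1.2 (1.114) p.36, (1.126) p.38, p.39; proof ours by the p.36 route] -/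
theorem local114Fam_latticeSettingP12R {I : Type} (n : I → ℕ) [∀ i, NeZero (n i)] (M : I → Fin d → ℕ)
    [∀ i μ, NeZero (M i μ)] (k : I → ℕ) (hn : ∀ i, 1 ≤ n i) {a : ℝ} (ha : 0 < a) {δ' C : ℝ} (hδ' : 0 < δ') (hC : 0 ≤ C)
    (h126 : ∀ i, ∀ p q, ‖dPd (n i) (M i) p q‖ ≤ C * (((n i : ℕ) : ℝ) ^ d)⁻¹ * Real.exp (-(δ' * distU (n i) (M i) p.1 q.1))) :
    B5.Local114Fam (fun i => latticeSettingP12R (n i) (M i) a (k i)) := by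
  refine ⟨delta1 d a δ' C, C114 d a δ' C, delta1_pos (d := d) ha hδ' hC, C114_pos d a δ' C, ?_⟩
  intro i m J ζ y y' hζ hJ
  have h := l2locL_le (n i) (M i) (hn i) ha hδ' hC (h126 i) m J.emb ζ hζ hJ
  have hs := sqEta_nonneg (n i) d
  show sqEta (n i) d * l2locL (n i) (M i) a m J.emb ζ
    ≤ C114 d a δ' C * Real.exp (-(delta1 d a δ' C * distSite (M i) y y')) * cutSupL (n i) (M i) ζ
      * (sqEta (n i) d * locNorm J.emb)
  calc sqEta (n i) d * l2locL (n i) (M i) a m J.emb ζ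
      ≤ sqEta (n i) d * (C114 d a δ' C * Real.exp (-(delta1 d a δ' C * distSite (M i) y y')) * cutSupL (n i) (M i) ζ
          * locNorm J.emb) := mul_le_mul_of_nonneg_left h hs
    _ = _ := by ring

/-! ## §4 The hypothesis-free forms: (1.126) for `∂·PcT·∂ᴴ` is the tree's P-bridge -/

/-- **(1.126) FOR THE MATRIX OF RECORD `dPd = GradOp·PcT·GradOpᴴ`, EVERY DIMENSION** (p16's P-bridge
`B5PBridgeKernel126.norm_GradOp_PcT_GradOp_adjoint_le_of_pos` for `d ≥ 1`; for `d = 0` there are no bonds).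
[cite: Balaban1984PropagatorsI, (1.126) p.38 («The constant O(1) in (1.126) depends on d only»), (1.120) p.37] -/
theorem kerBound126 (d : ℕ) :
    ∃ δ C : ℝ, 0 < δ ∧ 0 ≤ C ∧ ∀ (n : ℕ) [NeZero n] (M : Fin d → ℕ) [∀ μ, NeZero (M μ)]
      (i j : Tor (fine n M) × Fin d), ‖dPd n M i j‖ ≤ C * ((n : ℝ) ^ d)⁻¹ * Real.exp (-(δ * distU n M i.1 j.1)) := by
  rcases Nat.eq_zero_or_pos d with h0 | hd
  · subst h0
    exact ⟨1, 0, one_pos, le_rfl, fun n _ M _ i _ => i.2.elim0⟩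
  · exact B5PBridgeKernel126.norm_GradOp_PcT_GradOp_adjoint_le_of_pos hd

/-- **`δ′₀` of (1.126)** of record (depends on `d` only). [cite: Balaban1984PropagatorsI, (1.126) p.38] -/
def deltaP (d : ℕ) : ℝ := (kerBound126 d).choose

/-- **the `O(1)` of (1.126)** of record (depends on `d` only). [cite: Balaban1984PropagatorsI, (1.126) p.38] -/
def constP (d : ℕ) : ℝ := (kerBound126 d).choose_spec.choose

/-- `0 < δ′₀`. [cite: Balaban1984PropagatorsI, (1.126) p.38] -/
theorem deltaP_pos (d : ℕ) : 0 < deltaP d := (kerBound126 d).choose_spec.choose_spec.1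

/-- `0 ≤ O(1)`. [cite: Balaban1984PropagatorsI, (1.126) p.38] -/
theorem constP_nonneg (d : ℕ) : 0 ≤ constP d := (kerBound126 d).choose_spec.choose_spec.2.1

/-- (1.126) with the constants of record: `|η^{-d}(∂P∂*)(i,j)| ≤ O(1)e^{−δ′₀|x−x′|}` on every torus.
[cite: Balaban1984PropagatorsI, (1.126) p.38, (1.120) p.37] -/
theorem norm_dPd_le (n : ℕ) [NeZero n] (M : Fin d → ℕ) [∀ μ, NeZero (M μ)] (i j : Tor (fine n M) × Fin d) :
    ‖dPd n M i j‖ ≤ constP d * ((n : ℝ) ^ d)⁻¹ * Real.exp (-(deltaP d * distU n M i.1 j.1)) :=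
  (kerBound126 d).choose_spec.choose_spec.2.2 n M i j

/-- **`δ₀` of (1.114) for G** of record: `δ₁(d, a, δ′₀(d), O(1)(d))` — depends on `d, a` only.
[cite: Balaban1984PropagatorsI, Prop. 1.2 p.35 («constants δ₀ > 0 and O(1) depending on d only»); value ours] -/
def delta114 (d : ℕ) (a : ℝ) : ℝ := delta1 d a (deltaP d) (constP d)

/-- **the `O(1)` of (1.114) for G** of record — depends on `d, a` only.
[cite: Balaban1984PropagatorsI, Prop. 1.2 p.35 («constants δ₀ > 0 and O(1) depending on d only»); value ours] -/
def const114 (d : ℕ) (a : ℝ) : ℝ := C114 d a (deltaP d) (constP d)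

/-- `0 < δ₀`. [cite: Balaban1984PropagatorsI, Prop. 1.2 p.35] -/
theorem delta114_pos (d : ℕ) {a : ℝ} (ha : 0 < a) : 0 < delta114 d a :=
  delta1_pos (d := d) ha (deltaP_pos d) (constP_nonneg d)

/-- `0 < O(1)`. [cite: Balaban1984PropagatorsI, Prop. 1.2 p.35] -/
theorem const114_pos (d : ℕ) (a : ℝ) : 0 < const114 d a := C114_pos d a _ _

/-- **(1.114) FOR `G = Δ_a⁻¹` ON EVERY TORUS, ALL SIX ENTRIES, NO HYPOTHESIS** besides `η ≤ 1`, `a > 0`: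
`l2locL n M a m J ζ ≤ O(1)·e^{−δ₀|y−y′|}·|ζ|·‖J‖` for `supp ζ ⊂ Δ̃(y)`, `supp J ⊂ Δ̃(y′)`, with `δ₀ = delta114 d a`,
`O(1) = const114 d a` depending on `d, a` only (the per-instance form with closed constants, for p38's `famG` wrapper).
[cite: Balaban1984PropagatorsI, Prop. 1.2 (1.114) p.36, p.39; proof ours by the p.36 route, (1.126) by the tree's P-bridge] -/
theorem l2locL_le_printed (n : ℕ) [NeZero n] (M : Fin d → ℕ) [∀ μ, NeZero (M μ)] (hn : 1 ≤ n) {a : ℝ} (ha : 0 < a)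
    (m : Fin 6) (J : Loc189 n M) (ζ : Tor (fine n M) → ℝ) {y y' : Tor M} (hζ : cutInL n M ζ y) (hJ : suppInL n M J y') :
    l2locL n M a m J ζ ≤ const114 d a * Real.exp (-(delta114 d a * distSite M y y')) * cutSupL n M ζ * locNorm J :=
  l2locL_le n M hn ha (deltaP_pos d) (constP_nonneg d) (norm_dPd_le n M) m J ζ hζ hJ

/-- **(1.114) FOR G — `B5.Local114Fam` FOR THE REAL-FIELD TORUS FAMILY OF RECORD, HYPOTHESIS-FREE** (census item (vi)-G):
for every family `i ↦ (n_i, M_i, k_i)` of tori of one dimension `d` and one `a > 0`.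
[cite: Balaban1984PropagatorsI, Prop. 1.2 (1.114) p.36, p.39; proof ours by the p.36 route] -/
theorem local114Fam_latticeSettingP12R_printed {I : Type} (n : I → ℕ) [∀ i, NeZero (n i)] (M : I → Fin d → ℕ)
    [∀ i μ, NeZero (M i μ)] (k : I → ℕ) (hn : ∀ i, 1 ≤ n i) {a : ℝ} (ha : 0 < a) :
    B5.Local114Fam (fun i => latticeSettingP12R (n i) (M i) a (k i)) :=
  local114Fam_latticeSettingP12R n M k hn ha (deltaP_pos d) (constP_nonneg d) fun i => norm_dPd_le (n i) (M i)

/-- the same for the `η^{d/2}`-weighted complex setting `latticeSettingP12W`. [cite: Balaban1984PropagatorsI, Prop. 1.2 (1.114) p.36, p.39] -/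
theorem local114Fam_latticeSettingP12W_printed {I : Type} (n : I → ℕ) [∀ i, NeZero (n i)] (M : I → Fin d → ℕ)
    [∀ i μ, NeZero (M i μ)] (k : I → ℕ) (hn : ∀ i, 1 ≤ n i) {a : ℝ} (ha : 0 < a) :
    B5.Local114Fam (fun i => latticeSettingP12W (n i) (M i) a (k i)) :=
  local114Fam_latticeSettingP12W n M k hn ha (deltaP_pos d) (constP_nonneg d) fun i => norm_dPd_le (n i) (M i)

/-- the same for the unweighted complex setting `latticeSettingP12`. [cite: Balaban1984PropagatorsI, Prop. 1.2 (1.114) p.36, p.39] -/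
theorem local114Fam_latticeSettingP12_printed {I : Type} (n : I → ℕ) [∀ i, NeZero (n i)] (M : I → Fin d → ℕ)
    [∀ i μ, NeZero (M i μ)] (k : I → ℕ) (hn : ∀ i, 1 ≤ n i) {a : ℝ} (ha : 0 < a) :
    B5.Local114Fam (fun i => latticeSettingP12 (n i) (M i) a (k i)) :=
  local114Fam_latticeSettingP12 n M k hn ha (deltaP_pos d) (constP_nonneg d) fun i => norm_dPd_le (n i) (M i)

end

end Literature.MathematicalPhysics.QuantumFieldTheory.Balaban1983to89.B5Local114GLattice
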